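import Literature.Geometry.DiscreteGeometry.KissingArccosBrackets
import Literature.Geometry.DiscreteGeometry.TameContactGraphs
import Literature.Analysis.ValidatedNumerics.IntervalFunctions
import HarnessLib

/-!
# The growth-search checker (computable part) — K25 copy at `κ = 7/32` (`h = 5/4`), part 1/3

HONEST FRAMING (cell pub-crystal3d, K-path at `h = 5/4`): this is NOT a result printed by Hales.  It is his
METHOD (arXiv:1209.6043, Theorem 3: the main estimate + the classification of the contact graphs of kissing
configurations, in the tree's form of a verified interval-arithmetic growth search, `Literature/…/KissingSearch*.lean`)
RE-RUN at the separation `5/2` instead of `2h₀ = 2.52` (largest long-side cosine `κ = 1 − (5/4)²/2 = 7/32` instead of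
`κ₀ = 1031/5000`).  The declarations are namespace-shadowing COPIES of the tree's declarations (same names, inside
`namespace Summit.Ventures.Crystal3D.Kissing125[.KissingSearch]`, original docstrings and citation tags kept — the tags
name the printed METHOD step each declaration implements); the diff to the originals is stated per file.  Generated by
`HOME/lean/kissing125/gen/mkfiles.py`; audit recipe in `HOME/lean/kissing125/README.md`.  Nothing here is asserted
about GAP(1.26) or any census.

THIS FILE: copy of `Literature/Geometry/DiscreteGeometry/KissingSearchCheck.lean` with EXACTLY ONE semantic change, `def κ0 : ℚ := 7 / 32` (was `1031 / 5000`); everything else (cells `K = 15`, `δ = 1/2048`, tables, rules, roots, parts) byte-identical up to the namespace line.  (Part 1 of 3: lines 1–314 of the transformed copy; the split is only for the 400-line rule.)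

## References
* T. C. Hales, *A proof of Fejes Tóth's conjecture on sphere packings with kissing number twelve*,
  arXiv:1209.6043 (2012): Definition 1, Theorem 2 (main estimate `d₃`), Theorem 3, Lemmas 7–10. [`Hales2012`]
* R. E. Moore, *Interval Analysis* (1966), Theorem 3.1, §4.4. [`Moore1966`]
-/

namespace Summit.Ventures.Crystal3D.Kissing125

open Literature.Geometry.DiscreteGeometry

namespace KissingSearch

open Literature.Analysis.ValidatedNumerics KissingLP

/-! ### Part A. Numeric kernel -/

/-- Number of cells of the cosine grid of a long side. [folklore] -/
def K : ℕ := 15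
/-- `κ₀ := 7/32 = 1 − (5/4)²/2`, the largest cosine of a long side at the separation `dist ≥ 5/2` (the tree's
run of Hales's class uses `1031/5000` for `2h₀ = 2.52`). [cite: Hales2012, Definition 1] -/
def κ0 : ℚ := 7 / 32
/-- Grid point `j` (`j = 0 … K`): `-1/2 + j (κ₀ + 1/2)/K`. [folklore] -/
def gridPt (j : ℕ) : ℚ := -1 / 2 + (κ0 + 1 / 2) * j / K
/-- A closed rational interval from two endpoints in either order. [folklore] -/
def mkIv (a b : ℚ) : NonemptyInterval ℚ := ⟨(min a b, max a b), min_le_max⟩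
/-- The cosine interval of a side symbol: `0` = contact (`1/2`), `j = 1 … K` = cell
`[gridPt (j-1), gridPt j]`. [folklore] -/
def symIv (s : ℕ) : NonemptyInterval ℚ :=
  if s = 0 then mkIv (1 / 2) (1 / 2) else mkIv (gridPt (s - 1)) (gridPt s)

/-- Angle unit `δ = 1/2048` rad. [folklore] -/
def δ : ℚ := 1 / 2048
/-- Ladder length (`6435 δ > 3.1416`). [folklore] -/
def NLAD : ℕ := 6435
/-- `12867 δ < 2π`. [folklore] -/
def TWOPI_LO : ℕ := 12867
/-- `2π < 12868 δ`. [folklore] -/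
def TWOPI_HI : ℕ := 12868
/-- Working dyadic precision of the interval arithmetic. [folklore] -/
def PREC : ℕ := 40
/-- Heron iterations for square roots. [folklore] -/
def ITERS : ℕ := 8

/-- The law-of-cosines quotient `(z - x y) / (√(1-x²) √(1-y²))` (variables `0,1` = the two sides
at the vertex, `2` = the opposite side). [folklore] -/
def qExpr : RExpr :=
  .mul (.sub (.var 2) (.mul (.var 0) (.var 1)))
    (.inv (.mul (.sqrt (.sub (.const 1) (.sq (.var 0)))) (.sqrt (.sub (.const 1) (.sq (.var 1))))))

/-- The circumradius polynomial
`P = 1 + 8xyz - 3(x²+y²+z²) + 2(x+y+z) - 2(xy+xz+yz)` (`P > 0` iff circumradius `< 60°`).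
[folklore] -/
def pExpr : RExpr :=
  .sub (.add (.add (.const 1) (.mul (.const 8) (.mul (.var 0) (.mul (.var 1) (.var 2)))))
      (.mul (.const 2) (.add (.var 0) (.add (.var 1) (.var 2)))))
    (.add (.mul (.const 3) (.add (.sq (.var 0)) (.add (.sq (.var 1)) (.sq (.var 2)))))
      (.mul (.const 2) (.add (.mul (.var 0) (.var 1)) (.add (.mul (.var 0) (.var 2)) (.mul (.var 1) (.var 2))))))

/-- The box of a symbol triple. [folklore] -/
def symBox (a b c : ℕ) : ℕ → NonemptyInterval ℚ :=
  fun i => if i = 0 then symIv a else if i = 1 then symIv b else symIv c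

/-- A BRACKET is a natural number `16384 lo + hi + 1` (`hi < 16384`: the angle lies in
`[lo δ, hi δ]`), or `NOBR = 0` = infeasible / empty. [folklore] -/
def NOBR : ℕ := 0
/-- Make a bracket. [folklore] -/
def mkBr (lo hi : ℕ) : ℕ := 16384 * lo + hi + 1
/-- Lower end of a bracket. [folklore] -/
def brLo (br : ℕ) : ℕ := (br - 1) / 16384
/-- Upper end of a bracket. [folklore] -/
def brHi (br : ℕ) : ℕ := (br - 1) % 16384
/-- Hull of two brackets (`NOBR` neutral). [folklore] -/
def brHull (x y : ℕ) : ℕ :=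
  if x = NOBR then y else if y = NOBR then x else mkBr (min (brLo x) (brLo y)) (max (brHi x) (brHi y))

/-- Monotone form of the certificate `arccos q ≤ k δ`: test `arccosLeB` at `min (k δ) (13/5)`
(the polynomial bracket is only used on `[0, 13/5]`; a certificate at `13/5` serves every
larger angle).  Monotonicity in `k` is what makes the binary search of `ladUp` find the least
certified rung; soundness does not depend on it. [folklore] -/
def upOK (q : ℚ) (k : ℕ) : Bool := arccosLeB q (min ((k : ℚ) * δ) (13 / 5))

/-- **`ladUp q`**: a rung `k ≤ NLAD` with `arccos q ≤ k δ` (binary search on `upOK`; `NLAD`, which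
is certified since `NLAD δ ≥ 3.1416`, if the search fails). [folklore] -/
def ladUp (q : ℚ) : ℕ :=
  let k := bsearchMin (upOK q) (NLAD + 1) 0 NLAD
  if upOK q k then k else NLAD

/-- **`ladDown q`**: a rung `k` with `k δ ≤ arccos q` (`ladderDown` of
`KissingArccosBrackets.lean`). [folklore] -/
def ladDown (q : ℚ) : ℕ := ladderDown δ NLAD q

/-- **The basic bracket of a slot** over a triple of symbols (`a`, `b` the sides at the vertex,
`c` the opposite side): `NOBR` if the circumradius polynomial is certified `≤ 0` on the box,
otherwise the ladder bracket of `arccos` of the enclosed quotient. [folklore] -/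
def basic (a b c : ℕ) : ℕ :=
  match pExpr.enclose PREC ITERS (symBox a b c) with
  | none => mkBr 0 NLAD
  | some P =>
    if P.snd ≤ 0 then NOBR
    else
      match qExpr.enclose PREC ITERS (symBox a b c) with
      | none => mkBr 0 NLAD
      | some Q => mkBr (ladDown (dyCeil PREC Q.snd)) (ladUp (dyFloor PREC Q.fst))

/-- Number of symbols `K + 1`. [folklore] -/
def NS : ℕ := K + 1

/-- The table of basic brackets, flat index `(a * NS + b) * NS + c`. [folklore] -/
def BTAB : Array ℕ := Array.ofFn (n := NS * NS * NS) fun i =>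
  basic (i.1 / (NS * NS)) ((i.1 / NS) % NS) (i.1 % NS)

/-- Lookup in `BTAB`. [folklore] -/
def btab (a b c : ℕ) : ℕ := BTAB.getD ((a * NS + b) * NS + c) NOBR

/-- A side DOMAIN code: `0` = contact; `1 + 16 lo + hi` = long side with cosine in the cells
`lo … hi` (`1 ≤ lo ≤ hi ≤ K`); `UNL` = not yet labelled. [folklore] -/
def UNL : ℕ := 4096
/-- Range code of cells `lo … hi`. [folklore] -/
def mkR (lo hi : ℕ) : ℕ := 1 + 16 * lo + hi
/-- Lower cell of a range code. [folklore] -/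
def rLo (r : ℕ) : ℕ := (r - 1) / 16
/-- Upper cell of a range code. [folklore] -/
def rHi (r : ℕ) : ℕ := (r - 1) % 16
/-- The full long range. [folklore] -/
def FULLR : ℕ := mkR 1 K

/-- Fold `f` over `i, i+1, …, i+n-1`. [folklore] -/
def foldRange {β : Type} (f : β → ℕ → β) : ℕ → ℕ → β → β
  | _, 0, acc => acc
  | i, n + 1, acc => foldRange f (i + 1) n (f acc i)

/-- Fold over the symbols of a domain code (contact ↦ the symbol `0`). [folklore] -/
def foldSyms {β : Type} (f : β → ℕ → β) (r : ℕ) (acc : β) : β :=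
  if r = 0 then f acc 0 else foldRange f (rLo r) (rHi r + 1 - rLo r) acc

/-- Bracket over an opposite-side domain for fixed vertex-side symbols. [folklore] -/
def rangeC (a b r : ℕ) : ℕ := foldSyms (fun acc c => brHull acc (btab a b c)) r NOBR

/-- Table of `rangeC`, flat index `(a * NS + b) * 256 + (16 lo + hi)`, the contact domain at
`(0, 0)`. [folklore] -/
def T1TAB : Array ℕ := Array.ofFn (n := NS * NS * 256) fun i =>
  let ab := i.1 / 256
  let lh := i.1 % 256
  if lh = 0 then rangeC (ab / NS) (ab % NS) 0 else rangeC (ab / NS) (ab % NS) (mkR (lh / 16) (lh % 16))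

/-- Lookup in `T1TAB` by the domain code of the opposite side. [folklore] -/
def t1 (a b r : ℕ) : ℕ :=
  T1TAB.getD ((a * NS + b) * 256 + (if r = 0 then 0 else 16 * rLo r + rHi r)) NOBR

/-- **Bracket of a slot over three side domains** (`ra`, `rb` at the vertex, `rc` opposite).
[folklore] -/
def rangeBr (ra rb rc : ℕ) : ℕ :=
  if ra = 0 then (if rb = 0 then t1 0 0 rc else foldSyms (fun acc b => brHull acc (t1 0 b rc)) rb NOBR)
  else if rb = 0 then foldSyms (fun acc a => brHull acc (t1 a 0 rc)) ra NOBR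
  else foldSyms (fun acc a => foldSyms (fun acc' b => brHull acc' (t1 a b rc)) rb acc) ra NOBR

/-- The smallest lower end of any feasible basic bracket: a lower bound for every angle of
every fan triangle. [folklore] -/
def THMIN : ℕ := BTAB.foldl (fun m br => if br = NOBR then m else min m (brLo br)) NLAD

/-- The first cell reaching nonnegative cosines: `gridPt 10 < 0 ≤ gridPt 11`, so a cosine `≥ 0`
lies in a cell `≥ 11` (`gridPt_neg` in `KissingSearchRules.lean`). [folklore] -/
def ZCELL : ℕ := 11

/-! ### Part B. States, propagation, search -/

/-- A search state: the placed triangles (codes `256 a + 16 b + c`, `a < b < c < 12`), the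
domain code of every side `{a, b}` (index `12 a + b`, `a < b`), and the number of placed
triangles on every side (same indexing; a cache of `tris`). [folklore] -/
structure St where
  /-- placed triangles -/
  tris : Array ℕ
  /-- side domains -/
  dom : Array ℕ
  /-- side counts -/
  sc : Array ℕ
  deriving Inhabited

/-- Triangle code. [folklore] -/
def triCode (a b c : ℕ) : ℕ := 256 * a + 16 * b + c
/-- First vertex of a triangle code. [folklore] -/
def tv0 (t : ℕ) : ℕ := t / 256
/-- Second vertex. [folklore] -/
def tv1 (t : ℕ) : ℕ := (t / 16) % 16
/-- Third vertex. [folklore] -/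
def tv2 (t : ℕ) : ℕ := t % 16
/-- Whether `v` is a vertex of the triangle code `t`. [folklore] -/
def tmem (t v : ℕ) : Bool := tv0 t == v || tv1 t == v || tv2 t == v
/-- Sorted triangle code of three labels. [folklore] -/
def sortTri (a b c : ℕ) : ℕ :=
  let lo := min a (min b c)
  let hi := max a (max b c)
  triCode lo (a + b + c - lo - hi) hi
/-- The two other vertices of a triangle code seen from `v`. [folklore] -/
def others (t v : ℕ) : ℕ × ℕ :=
  if tv0 t = v then (tv1 t, tv2 t) else if tv1 t = v then (tv0 t, tv2 t) else (tv0 t, tv1 t)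

/-- Side index of `{a, b}`. [folklore] -/
def sIdx (a b : ℕ) : ℕ := if a < b then 12 * a + b else 12 * b + a
/-- Domain of a side. [folklore] -/
def St.gdom (s : St) (a b : ℕ) : ℕ := s.dom.getD (sIdx a b) UNL
/-- Set the domain of a side. [folklore] -/
def St.sdom (s : St) (a b r : ℕ) : St := { s with dom := s.dom.setIfInBounds (sIdx a b) r }
/-- Cached number of placed triangles on the side `{a, b}`. [folklore] -/
def St.gsc (s : St) (a b : ℕ) : ℕ := s.sc.getD (sIdx a b) 0
/-- Twice the number of placed triangles at `v` (sum of the side counts at `v`). [folklore] -/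
def St.hdeg2 (s : St) (v : ℕ) : ℕ := foldRange (fun n u => if u = v then n else n + s.gsc v u) 0 12 0
/-- Number of contact sides at `v`. [folklore] -/
def St.cdeg (s : St) (v : ℕ) : ℕ := foldRange (fun n u => if u ≠ v ∧ s.gdom u v = 0 then n + 1 else n) 0 12 0
/-- Number of sides labelled long. [folklore] -/
def St.nlong (s : St) : ℕ :=
  foldRange (fun n i => if i / 12 < i % 12 then
    (let r := s.dom.getD i UNL; if r ≠ 0 ∧ r ≠ UNL then n + 1 else n) else n) 0 144 0
/-- Number of used labels (labels with a placed triangle). [folklore] -/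
def St.nused (s : St) : ℕ := foldRange (fun n v => if s.hdeg2 v = 0 then n else n + 1) 0 12 0

/-- Bracket of the slot of triangle `t` at its vertex `v`. [folklore] -/
def St.slotBr (s : St) (t v : ℕ) : ℕ :=
  let p := others t v
  rangeBr (s.gdom v p.1) (s.gdom v p.2) (s.gdom p.1 p.2)

/-- The link neighbours of `a` in the placed link of `v`. [folklore] -/
def St.linkNbrs (s : St) (v a : ℕ) : List ℕ :=
  s.tris.foldl (fun l t =>
    if tmem t v && tmem t a && a != v then
      (let p := others t v; (if p.1 = a then p.2 else p.1) :: l)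
    else l) []

/-- Labels reachable from the front in the placed link of `v` (fuel-bounded search). [folklore] -/
def St.linkReach (s : St) (v : ℕ) : ℕ → List ℕ → List ℕ → List ℕ
  | 0, seen, _ => seen
  | _ + 1, seen, [] => seen
  | fuel + 1, seen, x :: front =>
    let nb := (s.linkNbrs v x).filter fun y => !(seen.contains y)
    s.linkReach v fuel (nb ++ seen) (nb ++ front)

/-- Link summary of `v` from the side counts: (number of link vertices, number of endpoints
= sides in exactly one triangle, some side in `≥ 3` triangles, the list of link vertices).
[folklore] -/
def St.linkSummary (s : St) (v : ℕ) : ℕ × ℕ × Bool × List ℕ :=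
  foldRange (fun (acc : ℕ × ℕ × Bool × List ℕ) u =>
    if u = v then acc
    else
      let c := s.gsc v u
      if c = 0 then acc
      else (acc.1 + 1, (if c = 1 then acc.2.1 + 1 else acc.2.1), (acc.2.2.1 || decide (3 ≤ c)),
        u :: acc.2.2.2)) 0 12 (0, 0, false, [])

/-- A list `C` of link vertices of `v` is CLOSED under the placed link: with `x` it contains the
other vertex of every placed triangle through `{v, x}`. [folklore] -/
def St.linkClosed (s : St) (v : ℕ) (C : List ℕ) : Bool :=
  C.all fun x => (s.linkNbrs v x).all fun y => C.contains y

/-- The placed link of `v` is inconsistent with a single-cycle link: a side in `≥ 3` triangles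
(`bad`), or a set `C` of link vertices closed under the placed link, all of whose sides at `v`
lie in two placed triangles, that misses a link vertex (a closed cycle plus more).  The candidate
sets `C` are the search components of the link vertices `verts`, each verified closed before
use. [folklore] -/
def St.badLink (s : St) (v : ℕ) (verts : List ℕ) (bad : Bool) : Bool :=
  bad || (verts.foldl (fun (acc : List ℕ × Bool) a =>
    if acc.2 || acc.1.contains a then acc
    else
      let C := s.linkReach v 24 [a] [a]
      (C ++ acc.1, s.linkClosed v C && C.all (fun x => s.gsc v x == 2) && verts.any fun z => !(C.contains z)))
    ([], false)).2

/-- First index `i ∈ [lo, lo + n)` satisfying `ok`, if any. [folklore] -/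
def firstOk (ok : ℕ → Bool) : ℕ → ℕ → Option ℕ
  | _, 0 => none
  | lo, n + 1 => if ok lo then some lo else firstOk ok (lo + 1) n
/-- Last index `i ∈ (hi - n, hi]` satisfying `ok`, if any. [folklore] -/
def lastOk (ok : ℕ → Bool) : ℕ → ℕ → Option ℕ
  | _, 0 => none
  | hi, n + 1 => if ok hi then some hi else lastOk ok (hi - 1) n

/-- Trim the domain of one side of the slot `(t, v)` (role `0`: side `{v,a}`, `1`: `{v,b}`,
`2`: `{a,b}`) to the cells whose bracket is feasible and meets the window `[wlo, whi]`,
removing cells from the two ends only; `none` if nothing is left. [cite: Moore1966, §4.4] -/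
def St.trimSide (s : St) (t v role wlo whi : ℕ) : Option St :=
  let p := others t v
  let a := p.1
  let b := p.2
  let ra := s.gdom v a
  let rb := s.gdom v b
  let rc := s.gdom a b
  let r := if role = 0 then ra else if role = 1 then rb else rc
  if r = 0 ∨ r = UNL then some s
  else
    let ok : ℕ → Bool := fun c =>
      let rr := mkR c c
      let br := if role = 0 then rangeBr rr rb rc else if role = 1 then rangeBr ra rr rc else rangeBr ra rb rr
      br != NOBR && brLo br ≤ whi && wlo ≤ brHi br
    let lo := rLo r
    let hi := rHi r
    match firstOk ok lo (hi + 1 - lo) with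
    | none => none
    | some lo' =>
      match lastOk ok hi (hi + 1 - lo') with
      | none => none
      | some hi' =>
        let r' := mkR lo' hi'
        if r' = r then some s
        else some (if role = 0 then s.sdom v a r' else if role = 1 then s.sdom v b r' else s.sdom a b r')

/-- The apexes (third vertices) of the placed triangles on the side `{a, b}`. [folklore] -/
def St.apexes (s : St) (a b : ℕ) : List ℕ :=
  s.tris.foldl (fun l t => if tmem t a && tmem t b then (tv0 t + tv1 t + tv2 t - a - b) :: l else l) []

/-- The placed triangles at `v`. [folklore] -/
def St.trisAt (s : St) (v : ℕ) : List ℕ := s.tris.foldr (fun t l => if tmem t v then t :: l else l) []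

/-- Sum of the lower / upper ends of the slot brackets at `v` over the given triangles at `v`
(`none` if a slot is infeasible). [folklore] -/
def St.slotSums (s : St) (v : ℕ) (tv : List ℕ) : Option (ℕ × ℕ) :=
  tv.foldl (fun acc t =>
    match acc with
    | none => none
    | some (sl, sh) =>
      (let br := s.slotBr t v; if br = NOBR then none else some (sl + brLo br, sh + brHi br))) (some (0, 0))

end KissingSearch
end Summit.Ventures.Crystal3D.Kissing125
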